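import Literature.Geometry.Lorentzian.DirectLimitTimeOrientation
import Literature.Geometry.Lorentzian.MGHDUniqueness
import Literature.Geometry.Lorentzian.CauchyDevelopmentIsometryClasses
import Literature.Geometry.Lorentzian.CommonDevelopmentEmbedding
import HarnessLib

/-!
# A chain of Cauchy developments as a directed system of manifolds along its (unique) embeddings
# (Choquet-Bruhat–Geroch 1969, proof of Thm. 3, p. 333: "By uniqueness, `ψ_αγ = ψ_βγ ψ_αβ`")

First half of the union-of-a-chain construction (the input `hchain` of the Zorn frame
`Literature.Geometry.Lorentzian.CauchyProblemMGHDExistenceProofs`, § "What remains", item (a)).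
Choquet-Bruhat–Geroch, Comm. Math. Phys. 14 (1969), proof of Thm. 3, p. 333: *"Let `{N_α}` be a
totally ordered subcollection of `𝓜`. For `N_α ≤ N_β` let `ψ_αβ` denote the corresponding map.
By uniqueness, `ψ_αγ = ψ_βγ ψ_αβ`. Let `K` denote the disjoint union of the `N_α` … and `K̃`
the set of equivalence classes"*.

For a chain `c` (for "is extended by", `CauchyDevelopment.EmbedsInto`) of Cauchy developments of
an initial data set `D`:

* `CauchyDevelopment.chainPreorder` — the preorder `EmbedsInto` on `↥c`, directed
  (`isDirectedOrder_chain`) since the chain is total;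
* `CauchyDevelopment.chainMap` — THE embedding `ψ_αβ : N_α → N_β` for `α ≤ β` (a choice; unique by
  `DataEmbedding.eq_of_comp_embed_eq`), with `chainMap_self : ψ_αα = id` and
  `chainMap_comp : ψ_βγ ∘ ψ_αβ = ψ_αγ` — *"By uniqueness, `ψ_αγ = ψ_βγ ψ_αβ`"*;
* `CauchyDevelopment.chainData c hc : SmoothDirectLimitData (EuclideanSpace ℝ (Fin (n + 1))) ↥c` —
  the chain as a smooth directed system along injective local diffeomorphisms
  (`Literature.Geometry.Manifold.DirectLimitManifold`), so that `(chainData c hc).Limit` is the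
  manifold `K̃`; the metrics, time orientations and their compatibilities
  (`chainMap_isIsometricImmersion`, `chainMap_preservesTimeOrientation`) feed
  `DirectLimitMetric` / `DirectLimitTimeOrientation`;
* `CauchyDevelopment.embedsInto_of_surjective` — an embedding of developments which is onto is
  invertible: the target embeds back (needed to compare developments with the same image in `K̃`).

## References

* Y. Choquet-Bruhat, R. Geroch, Comm. Math. Phys. 14 (1969) 329–335, proof of Thm. 3, p. 333.
  [ChoquetBruhatGeroch1969CMP]
* J. Sbierski, Ann. Henri Poincaré 17 (2016) 301–329 = arXiv:1309.7591, §3.1, corollary to the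
  first lemma (uniqueness of embeddings). [Sbierski2016AHP]
-/

noncomputable section

open scoped Manifold ContDiff Topology
open Bundle Set Function Filter _root_.Topology Literature.Geometry.Manifold

namespace Literature.Geometry.Lorentzian

universe u

variable {n : ℕ} {X : Type u} [TopologicalSpace X] [ChartedSpace (EuclideanSpace ℝ (Fin n)) X]
  [IsManifold (𝓡 n) ∞ X] [ConnectedSpace X] {D : InitialDataSet (𝓡 n) X}

namespace CauchyDevelopment

/-! ### The chain as a directed preorder -/

/-- The preorder "is extended by" (`EmbedsInto`) on a set `c` of Cauchy developments.
[cite: ChoquetBruhatGeroch1969CMP, proof of Thm. 3 (p. 333)] -/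
@[reducible] def chainPreorder (c : Set (CauchyDevelopment D)) : Preorder ↥c where
  le a b := a.1.EmbedsInto b.1
  le_refl a := EmbedsInto.refl a.1
  le_trans _ _ _ h₁ h₂ := DataEmbedding.EmbedsInto.trans h₁ h₂

attribute [local instance] chainPreorder

/-- Unfolding the chain order. [folklore] -/
theorem chain_le_iff {c : Set (CauchyDevelopment D)} {a b : ↥c} : a ≤ b ↔ a.1.EmbedsInto b.1 :=
  Iff.rfl

/-- A chain (totally preordered subset) is directed. [folklore] -/
theorem isDirectedOrder_chain {c : Set (CauchyDevelopment D)} (hc : IsChain EmbedsInto c) :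
    IsDirectedOrder ↥c := by
  refine ⟨fun a b ↦ ?_⟩
  by_cases hab : a.1 = b.1
  · exact ⟨b, chain_le_iff.2 (hab ▸ EmbedsInto.refl b.1), le_rfl⟩
  · rcases hc a.2 b.2 hab with h | h
    · exact ⟨b, h, le_rfl⟩
    · exact ⟨a, le_rfl, h⟩

/-! ### The transition maps -/

variable {c : Set (CauchyDevelopment D)}

/-- **The embedding `ψ_αβ : N_α → N_β`** for `α ≤ β` in the chain (a chosen witness of
`EmbedsInto`; unique by `DataEmbedding.eq_of_comp_embed_eq`).
[cite: ChoquetBruhatGeroch1969CMP, proof of Thm. 3 (p. 333)] -/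
def chainMap (a b : ↥c) (h : a ≤ b) : a.1.carrier → b.1.carrier :=
  Classical.choose (chain_le_iff.1 h)

/-- The defining properties of `ψ_αβ`: smooth, an open embedding, an isometric immersion,
time-orientation preserving, `ψ_αβ ∘ ι_α = ι_β`. [cite: ChoquetBruhatGeroch1969CMP, proof of Thm. 3 (p. 333)] -/
theorem chainMap_spec (a b : ↥c) (h : a ≤ b) :
    ContMDiff (𝓡 (n + 1)) (𝓡 (n + 1)) ∞ (chainMap a b h) ∧ IsOpenEmbedding (chainMap a b h) ∧
      a.1.metric.IsIsometricImmersion b.1.metric.toPseudoRiemannianMetric (chainMap a b h) ∧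
      a.1.timeOrientation.PreservesTimeOrientation (chainMap a b h) b.1.timeOrientation ∧
      chainMap a b h ∘ a.1.embed = b.1.embed :=
  Classical.choose_spec (chain_le_iff.1 h)

/-- `ψ_αβ` is smooth. [folklore] -/
theorem contMDiff_chainMap (a b : ↥c) (h : a ≤ b) :
    ContMDiff (𝓡 (n + 1)) (𝓡 (n + 1)) ∞ (chainMap a b h) :=
  (chainMap_spec a b h).1

/-- `ψ_αβ` is an open embedding. [folklore] -/
theorem isOpenEmbedding_chainMap (a b : ↥c) (h : a ≤ b) : IsOpenEmbedding (chainMap a b h) :=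
  (chainMap_spec a b h).2.1

/-- `ψ_αβ` is an isometric immersion. [folklore] -/
theorem chainMap_isIsometricImmersion (a b : ↥c) (h : a ≤ b) :
    a.1.metric.IsIsometricImmersion b.1.metric.toPseudoRiemannianMetric (chainMap a b h) :=
  (chainMap_spec a b h).2.2.1

/-- `ψ_αβ` preserves the time orientations. [folklore] -/
theorem chainMap_preservesTimeOrientation (a b : ↥c) (h : a ≤ b) :
    a.1.timeOrientation.PreservesTimeOrientation (chainMap a b h) b.1.timeOrientation :=
  (chainMap_spec a b h).2.2.2.1

/-- `ψ_αβ ∘ ι_α = ι_β`. [folklore] -/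
theorem chainMap_comp_embed (a b : ↥c) (h : a ≤ b) : chainMap a b h ∘ a.1.embed = b.1.embed :=
  (chainMap_spec a b h).2.2.2.2

/-- `ψ_αβ (ι_α x) = ι_β x`. [folklore] -/
theorem chainMap_embed (a b : ↥c) (h : a ≤ b) (x : X) : chainMap a b h (a.1.embed x) = b.1.embed x :=
  congr_fun (chainMap_comp_embed a b h) x

/-- `ψ_αβ` is a local diffeomorphism (an isometric immersion between equidimensional manifolds).
[folklore] -/
theorem isLocalDiffeomorph_chainMap (a b : ↥c) (h : a ≤ b) :
    IsLocalDiffeomorph (𝓡 (n + 1)) (𝓡 (n + 1)) ∞ (chainMap a b h) :=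
  LorentzianMetric.isLocalDiffeomorph_of_isIsometricImmersion (chainMap_isIsometricImmersion a b h)

/-- **"By uniqueness"**: `ψ_αα = id`. [cite: ChoquetBruhatGeroch1969CMP, proof of Thm. 3 (p. 333)] -/
theorem chainMap_self (a : ↥c) : chainMap a a le_rfl = id := by
  obtain ⟨hi, hτ, hι⟩ := a.1.toDataEmbedding.isIsometricImmersion_id
  exact DataEmbedding.eq_of_comp_embed_eq a.1.toDataEmbedding a.1.toDataEmbedding
    (chainMap_isIsometricImmersion a a le_rfl) (chainMap_preservesTimeOrientation a a le_rfl)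
    (chainMap_comp_embed a a le_rfl) hi hτ hι

/-- **"By uniqueness, `ψ_αγ = ψ_βγ ψ_αβ`."** [cite: ChoquetBruhatGeroch1969CMP, proof of Thm. 3 (p. 333)] -/
theorem chainMap_comp (a b d : ↥c) (hab : a ≤ b) (hbd : b ≤ d) :
    chainMap b d hbd ∘ chainMap a b hab = chainMap a d (hab.trans hbd) := by
  refine DataEmbedding.eq_of_comp_embed_eq a.1.toDataEmbedding d.1.toDataEmbedding ?_ ?_ ?_
    (chainMap_isIsometricImmersion a d _) (chainMap_preservesTimeOrientation a d _)
    (chainMap_comp_embed a d _)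
  · exact (chainMap_isIsometricImmersion b d hbd).comp (chainMap_isIsometricImmersion a b hab)
  · exact (chainMap_preservesTimeOrientation b d hbd).comp (chainMap_preservesTimeOrientation a b hab)
      (chainMap_isIsometricImmersion b d hbd).2
      ((contMDiff_chainMap b d hbd).mdifferentiable (by simp))
      ((contMDiff_chainMap a b hab).mdifferentiable (by simp))
  · rw [comp_assoc, chainMap_comp_embed, chainMap_comp_embed]

/-! ### The chain as a smooth directed system -/

variable (c) in
/-- **The chain as a smooth directed system of manifolds along injective local diffeomorphisms**
(`SmoothDirectLimitData`): pieces the spacetimes `N_α`, transition maps `ψ_αβ`. Its direct limit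
is the manifold `K̃` of Choquet-Bruhat–Geroch. [cite: ChoquetBruhatGeroch1969CMP, proof of Thm. 3 (p. 333)] -/
@[reducible] def chainData (hc : IsChain EmbedsInto c) :
    SmoothDirectLimitData (EuclideanSpace ℝ (Fin (n + 1))) ↥c :=
  letI := isDirectedOrder_chain hc
  { obj := fun a ↦ a.1.carrier
    map := fun a b h ↦ ⟨chainMap a b h, (contMDiff_chainMap a b h).continuous⟩
    directedSystem :=
      ⟨fun a x ↦ congr_fun (chainMap_self a) x,
        fun d b a hab hbd x ↦ congr_fun (chainMap_comp a b d hab hbd) x⟩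
    injective := fun a b h ↦ (isOpenEmbedding_chainMap a b h).injective
    isLocalDiffeomorph := fun a b h ↦ isLocalDiffeomorph_chainMap a b h }

/-- The transition maps of `chainData` are the `ψ_αβ`. [folklore] -/
@[simp] theorem chainData_map_apply (hc : IsChain EmbedsInto c) (a b : ↥c) (h : a ≤ b)
    (x : a.1.carrier) : (chainData c hc).map a b h x = chainMap a b h x := rfl

/-! ### Surjective embeddings are invertible -/

/-- **An embedding of Cauchy developments which is onto is an isometry of developments**, so the
target embeds back into the source (a bijective local diffeomorphism is a diffeomorphism,
`IsLocalDiffeomorph.diffeomorphOfBijective`; `IsIsometricTo.symm`, `IsIsometricTo.embedsInto`).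
[cite: Sbierski2016AHP, §2, Remark (1) after Def. 2.4 (isometry classes)] -/
theorem embedsInto_of_surjective {𝒟₁ 𝒟₂ : CauchyDevelopment D} {ψ : 𝒟₁.carrier → 𝒟₂.carrier}
    (hψi : 𝒟₁.metric.IsIsometricImmersion 𝒟₂.metric.toPseudoRiemannianMetric ψ)
    (hψτ : 𝒟₁.timeOrientation.PreservesTimeOrientation ψ 𝒟₂.timeOrientation)
    (hψc : ψ ∘ 𝒟₁.embed = 𝒟₂.embed) (hinj : Injective ψ) (hsurj : Surjective ψ) :
    𝒟₂.EmbedsInto 𝒟₁ := by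
  have hloc := LorentzianMetric.isLocalDiffeomorph_of_isIsometricImmersion hψi
  set Φ := hloc.diffeomorphOfBijective ⟨hinj, hsurj⟩ with hΦ
  have hΦψ : (Φ : 𝒟₁.carrier → 𝒟₂.carrier) = ψ := rfl
  have hiso : 𝒟₁.toDataEmbedding.IsIsometricTo 𝒟₂.toDataEmbedding := by
    refine ⟨Φ, fun y ↦ ?_, ?_, ?_⟩
    · change pullbackBilin (I := 𝓡 (n + 1)) (I' := 𝓡 (n + 1)) (⇑Φ) 𝒟₂.metric.val y = 𝒟₁.metric.val y
      rw [hΦψ]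
      exact hψi.2 y
    · change 𝒟₁.timeOrientation.PreservesTimeOrientation (⇑Φ) 𝒟₂.timeOrientation
      rw [hΦψ]
      exact hψτ
    · rw [hΦψ]
      exact hψc
  exact hiso.symm.embedsInto

end CauchyDevelopment

end Literature.Geometry.Lorentzian

end
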